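import Summits.QuantumFields.YangMills.Theorems.BalabanUVNodesN17AtRecord11
import Literature.MathematicalPhysics.QuantumFieldTheory.Balaban1983to89.Node00.Record11Beta
import Literature.MathematicalPhysics.QuantumFieldTheory.Balaban1983to89.Beta.AssemblyRemainder
import Literature.MathematicalPhysics.QuantumFieldTheory.Balaban1983to89.T4BetaMemorySharp

/-!
# BalabanUVNodes ∕ node N17 = NE4 AT THE β OF RECORD BY NAME (`Node00/Record11Beta`, def-B p451949): N17 at the Stage-11 datum IS the scale-shift
# rate of `betaOfRecord₁₁ θ` (every box) ∕ of `betaMergedOfRecord₁₁ θ` (boxes inside the record box); the split road at THE PRINTED SPLIT OF RECORD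
# `oneLoopSplitOfRecord₁₁ θ`; and what N17 DELIVERS to the β ∕ endpoint side (K2): (AF-0r) for the one-loop numbers of record `beta0OfRecord₁₁ θ`

Cell `pub-ymgap`, HUMAN RULING D-0062, seat `pub-ymgap-dag-n17-c` gen 2 (R134 fan-out, lane s2; dag-lead TABLE v23 row n17 ∕ REBALANCE №52 «N17 β-face re-point
UNBLOCKED by def-B p451949»), companion 10 (§34–§36) of the N17 lineage `…N17Knit` … `…N17AtRecord11` (p450153).  THEOREMS ONLY; imports companion 9
`…N17AtRecord11` (§31–§33: N17 at the Stage-11 datum with the merged β written OUT as the `letI`-assembly line) and seat node00-def-B's `Node00/Record11Beta`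
(the NAME LAYER: `betaMergedOfRecord₁₁ θ`, `beta0OfRecord₁₁ θ`, `betaOfRecord₁₁ θ` — all reducible — and the printed split of record `oneLoopSplitOfRecord₁₁ θ`,
`forwardGenerated_datumOfRecord₁₁`), plus the β sub-cell's `Beta/AssemblyRemainder` (K2's engine `endpointExistence_of_limit_remainderConst`) and
`T4BetaMemorySharp` (`remainderShiftRate_of_scaleShiftRate`); modifies nothing; every cited theorem used BY NAME.

WHY.  Companion 9 was typed BEFORE def-B's module landed, so every N17 face at ₁₁ displays the merged β of record as the raw term
`letI := θ.instVβ₁; …; betaMerged F (mergedTermFamilyMatT F N (TcOfRecord F N) (chiFixed7 F N θ.ν) θ.εbg) θ.ρ8 θ.bV`.  def-B's `Record11Beta` gives that term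
the NAME `betaMergedOfRecord₁₁ F N θ` (and `beta0OfRecord₁₁` ∕ `betaOfRecord₁₁` ∕ `oneLoopSplitOfRecord₁₁`), deliberately leaving «N17's β read-out — their rows
BY NAME over this file» (its header).  This companion is that row: the SAME kernel content re-keyed at the names (all `abbrev`s, so every proof is companion 9's
term or `Iff.rfl`), plus TWO things the names make sayable in the Literature's own vocabulary — (i) the split road through `B12Beta.OneLoopSplit` AT THE SPLIT
OF RECORD: `T4CouplingMatching.RemainderShiftRate (oneLoopSplitOfRecord₁₁ F N θ)` is the β¹-binder, (AF-0r) on `beta0OfRecord₁₁ F N θ` the β⁰-binder, and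
`scaleShiftRate_of_split` applies LITERALLY (no box-side cap: the split of record is a split of `betaOfRecord₁₁` on all histories); (ii) the N17 → K2 edge:
K2's engine `Beta.AssemblyRemainder.endpointExistence_of_limit_remainderConst` consumes `hconv : ∀ k, |S.β0 k − β⁰_∞| ≤ c₀ρ^k` at `S := oneLoopSplitOfRecord₁₁ θ`,
and `(oneLoopSplitOfRecord₁₁ θ).β0 = beta0OfRecord₁₁ θ` (`rfl`) is exactly the object N17 at the record delivers (AF-0r) for (companion 4 §15).
* §34 N17 AT THE β OF RECORD BY NAME: `N17_datumOfRecord₁₁_iff_betaOfRecord₁₁` (`Iff.rfl`, EVERY box side), `N17_datumOfRecord₁₁_iff_betaMergedOfRecord₁₁`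
  (`γ' ≤ θ.γ`), `n17At_datumOfRecord₁₁_iff_betaMergedOfRecord₁₁` (K4's letters), `u2Inputs_datumOfRecord₁₁_iff_betaMergedOfRecord₁₁` (node U2's triple),
  `N17_of_isRecordOfRecord₁₁C_betaMergedOfRecord₁₁` (the ₁₁C ∀-form in def-B's `hβm` shape — the N17 twin of `betaBoundsInInterval_of_isRecordOfRecord₁₁C_of_merged`).
* §35 THE SPLIT ROAD AT THE PRINTED SPLIT OF RECORD: `af0r_oneLoopSplitOfRecord₁₁_iff` (`Iff.rfl`), `remainderShiftRate_oneLoopSplitOfRecord₁₁_iff`,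
  **`N17_datumOfRecord₁₁_of_split₁₁`** ((AF-0r)(`beta0OfRecord₁₁ θ`) = N15 ∕ NODE O currency ∧ `RemainderShiftRate (oneLoopSplitOfRecord₁₁ θ) c₁ ρ γ'` = N16 ∕ N18
  ⟹ `NE4OnData (datumOfRecord₁₁ θ h) (2c₀+c₁) ρ γ'`, any `γ'`), `remainderShiftRate_oneLoopSplitOfRecord₁₁_of_N17` (converse), `N17_of_isRecordOfRecord₁₁C_split₁₁`.
* §36 WHAT N17 DELIVERS TO K2: `cauchy_beta0OfRecord₁₁_of_N17`, **`af0r_beta0OfRecord₁₁_of_N17`**, `tendsto_beta0OfRecord₁₁_of_N17`,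
  **`endpointExistence_datumOfRecord₁₁_of_N17`** (N17 + (AF-0∞) about THE limit + `RemainderConst` + the β box leaves ⟹ END at the Stage-11 datum, through
  K2's engine and def-B's `forwardGenerated_datumOfRecord₁₁` — every leaf displayed, N17 load-bearing), `af0r_beta0OfRecord₁₁_of_N17_isRecordOfRecord₁₁C`.

HONEST FRAMING.  Kernel bookkeeping BY NAME; 0 sorry, 0 def; NE4 NOT IN PRINT ([Balaban1987RG1] p. 264 «We will investigate other properties in a separate
paper») and NOT PROVED; (AF-0r) ∕ (AF-0∞) (GAPS G-an2-4, NODE O), `RemainderShiftRate` ∕ `RemainderConst` (N16 ∕ N18 ∕ the remainder chain), the β box leaves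
(`BetaUpperH`, `BetaContH`, the lower bound `−β'`), `Beta0LimitExists` and the reference-history clauses are DISPLAYED HYPOTHESES, never asserted; no inhabitant
of `IsRecordOfRecord₁₁C` claimed (K0 = stmt-QuantumFields-19673); N17 NOT discharged; K2 NOT closed; «A: n∕28» unmoved.  One finite four-torus at fixed ε per
run — NOT infinite volume, NOT OS on ℝ⁴, NOT a mass gap, NOT Clay.
-/

noncomputable section

open scoped Matrix.Norms.L2Operator

namespace Summit.QuantumFields.YangMills.Theorems.BalabanUVNodesN17

open Filter Topology
open Literature.MathematicalPhysics.QuantumFieldTheory.Balaban1983to89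
open Literature.MathematicalPhysics.QuantumFieldTheory.Balaban1983to89.FlowStep
open Literature.MathematicalPhysics.QuantumFieldTheory.Balaban1983to89.T4CouplingMatching
open Literature.MathematicalPhysics.QuantumFieldTheory.Balaban1983to89.T4Continuum (T4Family FiniteEpsData ULoop)
open Literature.MathematicalPhysics.QuantumFieldTheory.Balaban1983to89.Beta.RemainderChain (RemainderConst)
open Literature.MathematicalPhysics.QuantumFieldTheory.Balaban1983to89.Beta.AssemblyRemainder (endpointExistence_of_limit_remainderConst)
open Literature.MathematicalPhysics.QuantumFieldTheory.Balaban1983to89.T4BetaMemorySharp (remainderShiftRate_of_scaleShiftRate)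
open Literature.MathematicalPhysics.QuantumFieldTheory.Balaban1983to89.Node00
open Literature.MathematicalPhysics.QuantumFieldTheory.Balaban1983to89.DagBinding (WorldP EndpointExistence)
open Summit.QuantumFields.BalabanUV.T4Continuum.Spine.NE4 (NE4OnData U2Inputs ne4OnData_iff)
open YMDAG.UVSplit (Datum U3Carriers N17At)

variable {F : T4Family} {N : ℕ} [NeZero N]

/-! ## §34 N17 AT THE β OF RECORD BY NAME -/

/-- **N17 AT THE STAGE-11 DATUM IS THE SCALE-SHIFT RATE OF THE β OF RECORD `betaOfRecord₁₁ θ`** — on EVERY box side `γ'` (no cap: `NE4OnData D := ScaleShiftRate …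
D.βfun` and `(datumOfRecord₁₁ θ h).βfun = betaOfRecord₁₁ θ`, def-B's `βfun_datumOfRecord₁₁_eq_betaOfRecord₁₁`; `Iff.rfl`). [cite: Balaban1987RG1, (1.20)-(1.22) p.264] -/
theorem N17_datumOfRecord₁₁_iff_betaOfRecord₁₁ (θ : Stage11Params F N) (h : θ.Provisos₁₁) (c ρ γ' : ℝ) :
    NE4OnData (datumOfRecord₁₁ F N θ h) c ρ γ' ↔ ScaleShiftRate c ρ γ' (betaOfRecord₁₁ F N θ) := Iff.rfl

/-- **… AND, ON BOXES INSIDE THE RECORD BOX (`γ' ≤ θ.γ`), OF THE MERGED β OF RECORD `betaMergedOfRecord₁₁ θ`** (companion 9 `N17_datumOfRecord₁₁_iff_merged` at the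
name; `betaOfRecord₁₁ θ = betaMergedOfRecord₁₁ θ` on `]0,γ']^{k+1}`, def-B `betaOfRecord₁₁_eqOn_box`). [cite: Balaban1987RG1, (1.22) p.264 and (2.12)-(2.14) p.268] -/
theorem N17_datumOfRecord₁₁_iff_betaMergedOfRecord₁₁ (θ : Stage11Params F N) (h : θ.Provisos₁₁) {c ρ γ' : ℝ} (hγ : γ' ≤ θ.γ) :
    NE4OnData (datumOfRecord₁₁ F N θ h) c ρ γ' ↔ ScaleShiftRate c ρ γ' (betaMergedOfRecord₁₁ F N θ) :=
  N17_datumOfRecord₁₁_iff_merged θ h hγ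

/-- **… IN CLUSTER K4's LETTERS**: for node U3's carriers `u` with `u.γ ≤ θ.γ`, `N17At (datumOfRecord₁₁ θ h) u ↔ ScaleShiftRate (u.cr·u.C₅·u.θ) u.ρ u.γ
(betaMergedOfRecord₁₁ θ)` (companion 9 `n17At_datumOfRecord₁₁_iff_merged` at the name). [cite: Balaban1987RG1, (1.20)-(1.22) p.264] -/
theorem n17At_datumOfRecord₁₁_iff_betaMergedOfRecord₁₁ (θ : Stage11Params F N) (h : θ.Provisos₁₁) (u : U3Carriers) (hγ : u.γ ≤ θ.γ) :
    N17At (datumOfRecord₁₁ F N θ h) u ↔ ScaleShiftRate (u.cr * u.C₅ * u.θ) u.ρ u.γ (betaMergedOfRecord₁₁ F N θ) :=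
  n17At_datumOfRecord₁₁_iff_merged θ h u hγ

/-- **K4's letters, ANY box side**: `N17At (datumOfRecord₁₁ θ h) u ↔ ScaleShiftRate (u.cr·u.C₅·u.θ) u.ρ u.γ (betaOfRecord₁₁ θ)` (`Iff.rfl`).
[cite: Balaban1987RG1, (1.20)-(1.22) p.264] -/
theorem n17At_datumOfRecord₁₁_iff_betaOfRecord₁₁ (θ : Stage11Params F N) (h : θ.Provisos₁₁) (u : U3Carriers) :
    N17At (datumOfRecord₁₁ F N θ h) u ↔ ScaleShiftRate (u.cr * u.C₅ * u.θ) u.ρ u.γ (betaOfRecord₁₁ F N θ) := Iff.rfl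

/-- **NODE U2's INPUT TRIPLE AT THE STAGE-11 DATUM, BY NAME** (box `γ' ≤ θ.γ`): the `betaMergedOfRecord₁₁ θ` rate ∧ its history moduli ∧ the β-free fading-memory
clause (companion 9 `u2Inputs_datumOfRecord₁₁_iff` at the name). [cite: Balaban1987RG1, §5 p.298] -/
theorem u2Inputs_datumOfRecord₁₁_iff_betaMergedOfRecord₁₁ (θ : Stage11Params F N) (h : θ.Provisos₁₁) {c C ρ γ' : ℝ} {Λ : ℕ → ℕ → ℝ}
    (hγ : γ' ≤ θ.γ) :
    U2Inputs (datumOfRecord₁₁ F N θ h) c C ρ γ' Λ ↔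
      ScaleShiftRate c ρ γ' (betaMergedOfRecord₁₁ F N θ) ∧ HistLipschitz Λ γ' (betaMergedOfRecord₁₁ F N θ) ∧ FadingMemory C ρ Λ :=
  u2Inputs_datumOfRecord₁₁_iff θ h hγ

/-- **THE N17 BINDER OVER ₁₁C IN def-B's `hβm` SHAPE**: if at EVERY presentation `(θ, hP)` of the Stage-11 record `(D, w)` with `w.γ ≤ θ.γ` the merged β of record
`betaMergedOfRecord₁₁ θ` has the scale-shift rate `ScaleShiftRate cN ρ w.γ` on the binding world's own box, then `NE4OnData D cN ρ w.γ` — the N17 twin of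
`Node00.betaBoundsInInterval_of_isRecordOfRecord₁₁C_of_merged` (companion 9 `N17_of_isRecordOfRecord₁₁C` at the name).  Hypothesis displayed, not asserted.
[cite: Balaban1987RG1, (1.20)-(1.22) p.264; Balaban1989LargeFieldII, Thm 1 p.355] -/
theorem N17_of_isRecordOfRecord₁₁C_betaMergedOfRecord₁₁ {D : Datum F N} {w : WorldP} (h : IsRecordOfRecord₁₁C F N D w) {cN ρ : ℝ}
    (hβm : ∀ (θ : Stage11Params F N) (hP : θ.Provisos₁₁), θ.Admissible → D = datumOfRecord₁₁ F N θ hP → w.γ ≤ θ.γ →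
      ScaleShiftRate cN ρ w.γ (betaMergedOfRecord₁₁ F N θ)) :
    NE4OnData D cN ρ w.γ :=
  N17_of_isRecordOfRecord₁₁C h hβm

/-! ## §35 THE SPLIT ROAD AT THE PRINTED SPLIT OF RECORD `oneLoopSplitOfRecord₁₁ θ` («β⁰ conv + β¹ shift» in `B12Beta.OneLoopSplit` vocabulary) -/

/-- **(AF-0r) AT THE SPLIT OF RECORD IS (AF-0r) FOR THE ONE-LOOP NUMBERS OF RECORD** (`(oneLoopSplitOfRecord₁₁ θ).β0 = beta0OfRecord₁₁ θ`, def-B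
`oneLoopSplitOfRecord₁₁_β0`, `rfl`): the `hconv` input of K2's engine ∕ `Beta.Assembly.LimitForm.conv` at `S := oneLoopSplitOfRecord₁₁ θ` is a statement about
`beta0OfRecord₁₁ θ`. [cite: Balaban1987RG1, (2.12)-(2.14) p.268] -/
theorem af0r_oneLoopSplitOfRecord₁₁_iff (θ : Stage11Params F N) {binf c₀ ρ : ℝ} :
    (∀ k, |(oneLoopSplitOfRecord₁₁ F N θ).β0 k - binf| ≤ c₀ * ρ ^ k) ↔ ∀ k, |beta0OfRecord₁₁ F N θ k - binf| ≤ c₀ * ρ ^ k :=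
  Iff.rfl

/-- **THE β¹-BINDER AT THE SPLIT OF RECORD IS NE4's OWN PREDICATE FOR THE MERGED REMAINDER** on boxes inside the record box (`γ' ≤ θ.γ`):
`RemainderShiftRate (oneLoopSplitOfRecord₁₁ θ) c₁ ρ γ' ↔ ScaleShiftRate c₁ ρ γ' (betaMergedOfRecord₁₁ θ − beta0OfRecord₁₁ θ)` (companion 4
`remainderShiftRate_atRecord_iff`: the split's remainder is the boxed `𝟙·(βm − β⁰)`). [cite: Balaban1987RG1, (2.12)-(2.14) p.268] -/
theorem remainderShiftRate_oneLoopSplitOfRecord₁₁_iff (θ : Stage11Params F N) {c₁ ρ γ' : ℝ} (hγ : γ' ≤ θ.γ) :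
    RemainderShiftRate (oneLoopSplitOfRecord₁₁ F N θ) c₁ ρ γ' ↔
      ScaleShiftRate c₁ ρ γ' fun k w => betaMergedOfRecord₁₁ F N θ k w - beta0OfRecord₁₁ F N θ k :=
  remainderShiftRate_atRecord_iff (βm := betaMergedOfRecord₁₁ F N θ) (β0 := beta0OfRecord₁₁ F N θ) (γ := θ.γ)
    (oneLoopSplitOfRecord₁₁ F N θ) hγ

/-- **THE SPLIT ROAD AT THE STAGE-11 DATUM, LITERALLY THROUGH THE PRINTED SPLIT OF RECORD**: (AF-0r) `|β⁰_{k+1} − β⁰_∞| ≤ c₀ρ^k` for the one-loop numbers of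
record `beta0OfRecord₁₁ θ` (N15 = NE2 ∕ NODE O currency, GAPS G-an2-4) ∧ `RemainderShiftRate (oneLoopSplitOfRecord₁₁ θ) c₁ ρ γ'` (the remainder's scale-shift
rate: N16 = NE3 ∕ N18 = NE5), `0 ≤ ρ ≤ 1`, `0 ≤ c₀` ⟹ `NE4OnData (datumOfRecord₁₁ θ h) (2c₀ + c₁) ρ γ'` for EVERY box side `γ'` —
`T4CouplingMatching.scaleShiftRate_of_split` at `S := oneLoopSplitOfRecord₁₁ θ` and §34's `Iff.rfl`.  Both binders UNPRINTED, displayed. [cite: Balaban1987RG1, (2.12)-(2.14) p.268] -/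
theorem N17_datumOfRecord₁₁_of_split₁₁ (θ : Stage11Params F N) (h : θ.Provisos₁₁) {binf c₀ c₁ ρ γ' : ℝ} (hρ0 : 0 ≤ ρ) (hρ1 : ρ ≤ 1)
    (hc₀ : 0 ≤ c₀) (hconv : ∀ k, |beta0OfRecord₁₁ F N θ k - binf| ≤ c₀ * ρ ^ k)
    (hrem : RemainderShiftRate (oneLoopSplitOfRecord₁₁ F N θ) c₁ ρ γ') :
    NE4OnData (datumOfRecord₁₁ F N θ h) (2 * c₀ + c₁) ρ γ' :=
  scaleShiftRate_of_split (oneLoopSplitOfRecord₁₁ F N θ) hρ0 hρ1 hc₀ hconv hrem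

/-- **CONVERSELY: N17 AT THE STAGE-11 DATUM ∧ (AF-0r) FOR THE ONE-LOOP NUMBERS OF RECORD ⟹ THE REMAINDER's SCALE-SHIFT RATE AT THE SPLIT OF RECORD**,
constant `c + 2c₀`, every box side (`T4BetaMemorySharp.remainderShiftRate_of_scaleShiftRate` at `S := oneLoopSplitOfRecord₁₁ θ`). [folklore] -/
theorem remainderShiftRate_oneLoopSplitOfRecord₁₁_of_N17 (θ : Stage11Params F N) (h : θ.Provisos₁₁) {binf c₀ c ρ γ' : ℝ} (hρ0 : 0 ≤ ρ)
    (hρ1 : ρ ≤ 1) (hc₀ : 0 ≤ c₀) (hconv : ∀ k, |beta0OfRecord₁₁ F N θ k - binf| ≤ c₀ * ρ ^ k)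
    (hN17 : NE4OnData (datumOfRecord₁₁ F N θ h) c ρ γ') :
    RemainderShiftRate (oneLoopSplitOfRecord₁₁ F N θ) (c + 2 * c₀) ρ γ' :=
  remainderShiftRate_of_scaleShiftRate (oneLoopSplitOfRecord₁₁ F N θ) hρ0 hρ1 hc₀ hconv hN17

/-- **THE SPLIT ROAD OVER THE STAGE-11 RECORD**: if every presentation `(θ, hP)` of `(D, w)` with `w.γ ≤ θ.γ` carries (AF-0r) for `beta0OfRecord₁₁ θ` (constant
`c₀ ≥ 0`) and the remainder rate `RemainderShiftRate (oneLoopSplitOfRecord₁₁ θ) c₁ ρ w.γ`, `0 ≤ ρ ≤ 1`, then `NE4OnData D (2c₀ + c₁) ρ w.γ`.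
[cite: Balaban1987RG1, (2.12)-(2.14) p.268; Balaban1989LargeFieldII, Thm 1 p.355] -/
theorem N17_of_isRecordOfRecord₁₁C_split₁₁ {D : Datum F N} {w : WorldP} (h : IsRecordOfRecord₁₁C F N D w) {c₀ c₁ ρ : ℝ} (hρ0 : 0 ≤ ρ)
    (hρ1 : ρ ≤ 1) (hc₀ : 0 ≤ c₀)
    (hin : ∀ (θ : Stage11Params F N) (hP : θ.Provisos₁₁), θ.Admissible → D = datumOfRecord₁₁ F N θ hP → w.γ ≤ θ.γ →
      (∃ binf : ℝ, ∀ k, |beta0OfRecord₁₁ F N θ k - binf| ≤ c₀ * ρ ^ k) ∧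
        RemainderShiftRate (oneLoopSplitOfRecord₁₁ F N θ) c₁ ρ w.γ) :
    NE4OnData D (2 * c₀ + c₁) ρ w.γ := by
  obtain ⟨θ, hP, hθ, hD, -, ⟨-, hγle⟩, -, -⟩ := h
  obtain ⟨⟨binf, hconv⟩, hrem⟩ := hin θ hP hθ hD hγle
  subst hD
  exact N17_datumOfRecord₁₁_of_split₁₁ θ hP hρ0 hρ1 hc₀ hconv hrem

/-! ## §36 WHAT N17 DELIVERS TO THE β ∕ ENDPOINT SIDE (K2) AT THE RECORD: (AF-0r) for `beta0OfRecord₁₁ θ` = `(oneLoopSplitOfRecord₁₁ θ).β0` -/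

/-- **N17 AT THE STAGE-11 DATUM ⟹ THE CAUCHY FORM OF (AF-0r) FOR THE ONE-LOOP NUMBERS OF RECORD**: on a box side `0 < γ' ≤ θ.γ`, if the definer's one-sided
limit `Beta0LimitExists (betaMergedOfRecord₁₁ θ) θ.v₀` holds at COHERENT reference histories with entries in `]0,γ']`, then `NE4OnData (datumOfRecord₁₁ θ h) c ρ γ'`
gives `|β⁰_{k+2} − β⁰_{k+1}| ≤ cρ^k` for `β⁰ := beta0OfRecord₁₁ θ` (companion 4 `abs_beta0OfMerged_step_le`: pass to the limit `g → 0⁺` in the shift inequality;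
no corner bound). [cite: Balaban1987RG1, (2.12)-(2.14) p.268] -/
theorem cauchy_beta0OfRecord₁₁_of_N17 (θ : Stage11Params F N) (h : θ.Provisos₁₁) {c ρ γ' : ℝ} (hγ : γ' ≤ θ.γ) (hγ' : 0 < γ')
    (hlim : Beta0LimitExists (betaMergedOfRecord₁₁ F N θ) θ.v₀) (hcoh : ∀ k, Fin.tail (θ.v₀ (k + 1)) = θ.v₀ k)
    (hadm : ∀ k i, 0 < θ.v₀ k i ∧ θ.v₀ k i ≤ γ') (hN17 : NE4OnData (datumOfRecord₁₁ F N θ h) c ρ γ') (k : ℕ) :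
    |beta0OfRecord₁₁ F N θ (k + 1) - beta0OfRecord₁₁ F N θ k| ≤ c * ρ ^ k :=
  abs_beta0OfMerged_step_le hlim hcoh hadm hγ' ((N17_datumOfRecord₁₁_iff_betaMergedOfRecord₁₁ θ h hγ).mp hN17) k

/-- **N17 AT THE STAGE-11 DATUM ⟹ (AF-0r) FOR THE ONE-LOOP NUMBERS OF RECORD**: with `ρ < 1` in addition, `∃ β⁰_∞, ∀ k, |beta0OfRecord₁₁ θ k − β⁰_∞| ≤ (c∕(1−ρ))ρ^k`
— LITERALLY the `hconv` input of `Beta.AssemblyRemainder.endpointExistence_of_limit_remainderConst` ∕ `Beta.Assembly.LimitForm.conv` at the split of record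
(`af0r_oneLoopSplitOfRecord₁₁_iff`).  The node's β⁰-half is an OUTPUT at the record (companion 4 `af0r_beta0OfMerged_of_scaleShiftRate`). [cite: Balaban1987RG1, (2.12)-(2.14) p.268] -/
theorem af0r_beta0OfRecord₁₁_of_N17 (θ : Stage11Params F N) (h : θ.Provisos₁₁) {c ρ γ' : ℝ} (hγ : γ' ≤ θ.γ) (hγ' : 0 < γ') (hρ1 : ρ < 1)
    (hlim : Beta0LimitExists (betaMergedOfRecord₁₁ F N θ) θ.v₀) (hcoh : ∀ k, Fin.tail (θ.v₀ (k + 1)) = θ.v₀ k)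
    (hadm : ∀ k i, 0 < θ.v₀ k i ∧ θ.v₀ k i ≤ γ') (hN17 : NE4OnData (datumOfRecord₁₁ F N θ h) c ρ γ') :
    ∃ binf : ℝ, ∀ k, |beta0OfRecord₁₁ F N θ k - binf| ≤ c / (1 - ρ) * ρ ^ k :=
  af0r_beta0OfMerged_of_scaleShiftRate hlim hcoh hadm hγ' hρ1 ((N17_datumOfRecord₁₁_iff_betaMergedOfRecord₁₁ θ h hγ).mp hN17)

/-- A geometric rate to `b` forces convergence to `b` (so the `β⁰_∞` of (AF-0r) IS the limit of the one-loop numbers, and is unique). [folklore] -/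
theorem tendsto_of_abs_sub_le_geometric {a : ℕ → ℝ} {b C ρ : ℝ} (hρ0 : 0 ≤ ρ) (hρ1 : ρ < 1)
    (h : ∀ k, |a k - b| ≤ C * ρ ^ k) : Tendsto a atTop (𝓝 b) := by
  have h0 : Tendsto (fun k : ℕ => C * ρ ^ k) atTop (𝓝 0) := by
    simpa using (tendsto_pow_atTop_nhds_zero_of_lt_one hρ0 hρ1).const_mul C
  have h1 : Tendsto (fun k => a k - b) atTop (𝓝 0) :=
    squeeze_zero_norm (fun k => by simpa [Real.norm_eq_abs] using h k) h0
  exact tendsto_sub_nhds_zero_iff.mp h1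

/-- **N17 AT THE STAGE-11 DATUM ⟹ THE ONE-LOOP NUMBERS OF RECORD CONVERGE, AT A GEOMETRIC RATE** (`0 ≤ ρ < 1`): `∃ β⁰_∞, β⁰_k → β⁰_∞ ∧ |β⁰_k − β⁰_∞| ≤ (c∕(1−ρ))ρ^k`.
What remains for K2 on the one-loop side is the SIGN of that limit ((AF-0∞), NODE O's (2.14)), not its existence. [cite: Balaban1987RG1, (2.12)-(2.14) p.268] -/
theorem tendsto_beta0OfRecord₁₁_of_N17 (θ : Stage11Params F N) (h : θ.Provisos₁₁) {c ρ γ' : ℝ} (hγ : γ' ≤ θ.γ) (hγ' : 0 < γ') (hρ0 : 0 ≤ ρ)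
    (hρ1 : ρ < 1) (hlim : Beta0LimitExists (betaMergedOfRecord₁₁ F N θ) θ.v₀) (hcoh : ∀ k, Fin.tail (θ.v₀ (k + 1)) = θ.v₀ k)
    (hadm : ∀ k i, 0 < θ.v₀ k i ∧ θ.v₀ k i ≤ γ') (hN17 : NE4OnData (datumOfRecord₁₁ F N θ h) c ρ γ') :
    ∃ binf : ℝ, Tendsto (beta0OfRecord₁₁ F N θ) atTop (𝓝 binf) ∧ ∀ k, |beta0OfRecord₁₁ F N θ k - binf| ≤ c / (1 - ρ) * ρ ^ k := by
  obtain ⟨binf, hconv⟩ := af0r_beta0OfRecord₁₁_of_N17 θ h hγ hγ' hρ1 hlim hcoh hadm hN17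
  exact ⟨binf, tendsto_of_abs_sub_le_geometric hρ0 hρ1 hconv, hconv⟩

/-- **THE N17 → K2 EDGE AT THE STAGE-11 DATUM: ENDPOINT EXISTENCE FROM N17, THE SIGN OF THE ONE-LOOP LIMIT, THE CONSTANT-FORM REMAINDER AND THE β BOX LEAVES.**
N17 (`NE4OnData (datumOfRecord₁₁ θ h) c ρ γ'`, `0 < γ' ≤ θ.γ`, `0 ≤ ρ < 1`) with `Beta0LimitExists` at coherent admissible `θ.v₀` SUPPLIES (AF-0r) `hconv` for the split of
record (§36); the remaining leaves of K2's engine `Beta.AssemblyRemainder.endpointExistence_of_limit_remainderConst` are displayed: (AF-0∞) as a statement about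
THE limit of the one-loop numbers of record — `0 < β⁰_∞` and the printed-type restriction `r ≤ β⁰_∞∕4` for every `b` with `β⁰_k → b` (there is exactly one,
and by `tendsto_beta0OfRecord₁₁_of_N17` it exists; NODE O's (2.14)) —, the constant-form remainder `RemainderConst (oneLoopSplitOfRecord₁₁ θ) γ₀ r` (the remainder
chain, [II] (2.41) → [I] (5.10)), and on `]0,γ₀]` the upper bound `β ≤ β'`, the lower bound `−β' ≤ β` and B4 `BetaContH γ₀` for `betaOfRecord₁₁ θ`; forward generation
is def-B's `forwardGenerated_datumOfRecord₁₁`.  CONCLUSION: `EndpointExistence (datumOfRecord₁₁ θ h).C.toB12` — K2's conclusion at this datum.  Nothing asserted;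
N17 is load-bearing (without convergence of `β⁰_k` the sign clause is idle). [cite: Balaban1987RG1, Thm 2 p.259 (first sentence) and (2.12)-(2.14) p.268] -/
theorem endpointExistence_datumOfRecord₁₁_of_N17 (θ : Stage11Params F N) (h : θ.Provisos₁₁) {c ρ γ' γ₀ r β' : ℝ} (hγ : γ' ≤ θ.γ)
    (hγ' : 0 < γ') (hρ0 : 0 ≤ ρ) (hρ1 : ρ < 1) (hlim : Beta0LimitExists (betaMergedOfRecord₁₁ F N θ) θ.v₀)
    (hcoh : ∀ k, Fin.tail (θ.v₀ (k + 1)) = θ.v₀ k) (hadm : ∀ k i, 0 < θ.v₀ k i ∧ θ.v₀ k i ≤ γ')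
    (hN17 : NE4OnData (datumOfRecord₁₁ F N θ h) c ρ γ')
    (hAF0 : ∀ b : ℝ, Tendsto (beta0OfRecord₁₁ F N θ) atTop (𝓝 b) → 0 < b ∧ r ≤ b / 4)
    (hγ₀ : 0 < γ₀) (hrem : RemainderConst (oneLoopSplitOfRecord₁₁ F N θ) γ₀ r) (hup : BetaUpperH β' γ₀ (betaOfRecord₁₁ F N θ))
    (hlo : ∀ k, ∀ v ∈ Box γ₀ k, -β' ≤ betaOfRecord₁₁ F N θ k v) (hcont : BetaContH γ₀ (betaOfRecord₁₁ F N θ)) :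
    EndpointExistence (datumOfRecord₁₁ F N θ h).C.toB12 := by
  obtain ⟨binf, htend, hconv⟩ := tendsto_beta0OfRecord₁₁_of_N17 θ h hγ hγ' hρ0 hρ1 hlim hcoh hadm hN17
  obtain ⟨hbinf, hr⟩ := hAF0 binf htend
  have hc₀ : 0 ≤ c / (1 - ρ) := by
    have h0 := (abs_nonneg _).trans (hconv 0)
    simpa using h0
  exact endpointExistence_of_limit_remainderConst (forwardGenerated_datumOfRecord₁₁ F N θ h) (oneLoopSplitOfRecord₁₁ F N θ) hγ₀ hbinf hc₀
    hρ0 hρ1 hconv hrem hr hup hlo hcont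

/-- **WHAT N17 DELIVERS AT A STAGE-11 RECORD, BY NAME**: `NE4OnData D c ρ w.γ` with `ρ < 1`, and — asked of every presentation `(θ, hP)` of `(D, w)` with `w.γ ≤ θ.γ` —
`Beta0LimitExists (betaMergedOfRecord₁₁ θ) θ.v₀` at coherent reference histories with entries in `]0, w.γ]` ⟹ SOME presentation with (AF-0r)
`∃ β⁰_∞, |beta0OfRecord₁₁ θ k − β⁰_∞| ≤ (c∕(1−ρ))ρ^k` AND convergence `beta0OfRecord₁₁ θ → β⁰_∞` (companion 9 `af0r_of_N17_isRecordOfRecord₁₁C` at the name; `0 < w.γ`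
is the record's clause). [cite: Balaban1987RG1, (2.12)-(2.14) p.268; Balaban1989LargeFieldII, Thm 1 p.355] -/
theorem af0r_beta0OfRecord₁₁_of_N17_isRecordOfRecord₁₁C {D : Datum F N} {w : WorldP} (h : IsRecordOfRecord₁₁C F N D w) {c ρ : ℝ} (hρ0 : 0 ≤ ρ)
    (hρ1 : ρ < 1) (hN17 : NE4OnData D c ρ w.γ)
    (hin : ∀ (θ : Stage11Params F N) (hP : θ.Provisos₁₁), θ.Admissible → D = datumOfRecord₁₁ F N θ hP → w.γ ≤ θ.γ →
      Beta0LimitExists (betaMergedOfRecord₁₁ F N θ) θ.v₀ ∧ (∀ k, Fin.tail (θ.v₀ (k + 1)) = θ.v₀ k) ∧ ∀ k i, 0 < θ.v₀ k i ∧ θ.v₀ k i ≤ w.γ) :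
    ∃ (θ : Stage11Params F N) (hP : θ.Provisos₁₁), θ.Admissible ∧ D = datumOfRecord₁₁ F N θ hP ∧
      ∃ binf : ℝ, Tendsto (beta0OfRecord₁₁ F N θ) atTop (𝓝 binf) ∧ ∀ k, |beta0OfRecord₁₁ F N θ k - binf| ≤ c / (1 - ρ) * ρ ^ k := by
  obtain ⟨θ, hP, hθ, hD, -, ⟨hγ0, hγle⟩, -, -⟩ := h
  obtain ⟨hlim, hcoh, hadm⟩ := hin θ hP hθ hD hγle
  refine ⟨θ, hP, hθ, hD, ?_⟩
  subst hD
  exact tendsto_beta0OfRecord₁₁_of_N17 θ hP hγle hγ0 hρ0 hρ1 hlim hcoh hadm hN17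

end Summit.QuantumFields.YangMills.Theorems.BalabanUVNodesN17

end
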